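import Literature.MathematicalPhysics.QuantumFieldTheory.Balaban1983to89.Beta.LongitudinalWindow
import Literature.MathematicalPhysics.QuantumFieldTheory.Balaban1983to89.Beta.WoodburySymbol

/-!
# The continuum symbol of the line-3 longitudinal kernel `𝓛` and its infinite-volume limit `T ↗ ℤ^d`

HONEST SCOPE (page 1 of everything in this cell): discharging `BetaPertH` makes Bałaban's UV stability UNCONDITIONAL —
a real constructive-QFT result; it is NOT the continuum limit and NOT the Clay problem. This file is volume
BOOKKEEPING for one finite-volume certificate (`Beta/LongitudinalWindow`, line 3 of B5 (1.83)); it claims nothing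
about the summit.

WHAT IS PROVED (all `d ≥ 1`, block size `n ≥ 1`, `a > 0`; every statement kernel-checked, no hypotheses beyond the
displayed ones).
* §0 THE CONTINUUM FIBRE FUNCTIONS of a REAL coarse momentum `θ = p′ ∈ ℝ^d`: `X(θ)`, `φ_μ(θ)`, `Φ(θ)`,
  `a⁻¹Φ(θ)⁻¹ =: cT(θ)`, the square bracket `b(l,μ)(θ)` of (1.83), the leg amplitude
  `β(θ; x, μ) = Σ_l e^{i(θ+2πl)·x/n…} b(l,μ)(θ)` (`lampc`) and the FIBRE TERM
  `F_𝓛(θ; (x,μ),(x′,ν)) = cT(θ) β(θ;x,μ) \overline{β(θ;x′,ν)}` (`FL`) — written with the tree's B5 symbols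
  `uSym`, `vSym`, `dSym`, `d1Sym` (`B5Prop11Fiber`) and `WoodburySymbol.sig` / `phc`.
* §1 IDENTIFICATION: the torus fibre `B5FiberQQ.fiberAt q` IS `balabanFiber (sOf q)`, so its `cT`, `b(l,μ)` are the
  continuum functions at `θ = sOf q` (`rfl`); `cTAt q = cT(sOf q)` for EVERY class (both sides vanish at `q = 0`:
  `Φ(0) = 0` and Lean's `1/0 = 0` reproduce the absent zero mode), hence
  `𝓛((x,μ),(x′,ν)) = |T|⁻¹ Σ_{q ∈ T} F_𝓛(sOf q; (x,μ),(x′,ν))` (`Lker_eq_sum_FL`, a FULL coarse-momentum sum).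
* §2 `2π`-PERIODICITY of `F_𝓛` in `θ` (an integer shift of `θ` rotates the alias index, `WoodburySymbol.kshift`).
* §3 CONTINUITY of `F_𝓛` on the non-resonant set `{ε(θ) > 0} = ℝ^d ∖ (2πℤ)^d` (hence on the punctured zone): the
  only non-polynomial ingredient, `v_μ = ∂¹_μ/∂_μ` with its removable singularity, is the geometric mean
  `n⁻¹ Σ_{j<n} ω^j` (`vSym_eq_geom`); the denominators `Δ(θ+l)`, `φ_μ`, `Φ`, `X` are positive off `(2πℤ)^d`
  (`X`, `Φ` via the tree's `Fiber.X_pos` / `Fiber.Φ_pos` at the point reduced into the zone, plus periodicity).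
* §4 THE BOUNDED MAJORANT `‖F_𝓛(θ)‖ ≤ B_𝓛(d,a) := γ₊ L_b² a⁻¹ · 4d` on the whole zone — by DENSITY from the torus
  bound `LongitudinalWindow.fibre_term_lamp_le` (`≤ γ₊L_b²a⁻¹ Δ₀(p′)`, `Δ₀ ≤ 4d`) at the coarse momenta of the cubic
  tori, continuity (§3) and periodicity (§2); at `θ = 0` the symbol vanishes. (Line 3 has NO small denominator.)
* §5 ON A CUBIC TORUS `N^d 𝓛` IS A MOMENTUM AVERAGE OF THE SYMBOL (`Lker_cubic_eq`) and — by the bounded punctured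
  Riemann-sum theorem `PuncturedRiemannSum.momentumAverage_punctured_approx` — converges along the even cubic tori:
  `‖N^d 𝓛_{N,(m,…,m)}((x̂,μ),(x̂′,ν)) − (2π)^{-d}∫_{[-π,π]^d} F_𝓛 dθ‖ ≤ ε` for all even `m ≥ m₀` (`Lker_tendsto_infiniteVolume`,
  EVERY `d ≥ 1`).
* §6 THE LIMIT KERNEL `𝓛_∞((x,μ),(x′,ν)) := N^{-d}(2π)^{-d}∫F_𝓛` on integer points (`LkerLim`), `𝓛 → 𝓛_∞` entrywise
  (`Lker_tendsto_LkerLim`), and the transfer of the WHOLE window-grade package of `LongitudinalWindow` (K0, K1 in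
  either leg, K2; constants `C₀,C₁,C₂(d,a)` of that file): `norm_LkerLim_le` (`≤ C₀/N^d`), `norm_LkerLim_sub_left_le`,
  `norm_LkerLim_sub_right_le` (`≤ C₁/N^{d+1}`), `norm_LkerLim_sub_sub_le` (`≤ C₂/N^{d+2}`).

ROLE. Part (β) of the cell's gap G-an5g8-2 (the `T^{(j+1)} ↗ ℤ^d` bookkeeping of B12 p. 264) for the longitudinal
term `U^*𝓛̂U = 𝒢 − ⊕_μΓ_μ` of the one-step covariant propagator; together with `Beta/FreeLegDictionary` (free leg
`P`) and `Beta/WoodburySymbol` (`R⊥`) every piece of `𝒢 = ⊕_μ(P + R⊥) + U^*𝓛̂U` at `U = 1` now has a certified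
entrywise infinite-volume limit carrying its volume-uniform window bounds. NOT done here: `LargeLWindow` /
`WoodburyCovariant` (same pattern), convergence RATES, translation covariance of the limit kernels beyond `ℕ^d`
points, gauge fields `U ≠ 1`, the continuum limit.

SOURCES. T. Bałaban, Commun. Math. Phys. 95 (1984) 17–40 [Balaban1984PropagatorsI] («B5»), (1.83) p. 31 (the fibre
matrix; used only through the tree's `B5Prop11Bound.Fiber`, `B5Prop11Fiber.balabanFiber`, `Beta/LongitudinalWindow`),
(1.31) p. 23 and (1.61) p. 28 (the symbols `∂, ∂¹, v, u`); T. Bałaban, Commun. Math. Phys. 109 (1987) 249–301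
[Balaban1987RG1] («B12»), p. 264 (the infinite-volume bookkeeping this file performs for line 3);
everything else is [folklore] Fourier analysis on finite tori, proved here.
-/

open Finset Real MeasureTheory Filter Topology
open scoped BigOperators ComplexConjugate

namespace Literature.MathematicalPhysics.QuantumFieldTheory.Balaban1983to89.Beta.LongitudinalSymbol

open Literature.MathematicalPhysics.QuantumFieldTheory.Balaban1983to89.B5Prop11Plancherel (Tor fine chi sOf abs_sOf_le
  sOf_ne_zero sOf_zero unitVec)
open Literature.MathematicalPhysics.QuantumFieldTheory.Balaban1983to89.B4Strip (Sxir DeltaXir shiftr)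
open Literature.MathematicalPhysics.QuantumFieldTheory.Balaban1983to89.B5Block118 (pOf om om_pow dSym_eq_om)
open Literature.MathematicalPhysics.QuantumFieldTheory.Balaban1983to89.B5Prop11Fiber (uSym vSym dSym d1Sym balabanFiber)
open Literature.MathematicalPhysics.QuantumFieldTheory.Balaban1983to89.B5Prop11Bound (gammaPlus)
open Literature.MathematicalPhysics.QuantumFieldTheory.Balaban1983to89.Beta.FreeLegDictionary (cubic card_tor_fine_cubic)
open Literature.MathematicalPhysics.QuantumFieldTheory.Balaban1983to89.Beta.WoodburySymbol (sig phc kshift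
  kshift_injective om_shift sig_shift phc_shift sig_pos nonRes isOpen_nonRes brillouin_diff_subset_nonRes continuous_om
  continuous_phc continuous_sig vApprox thApprox tendsto_thApprox sOf_vApprox vApprox_class_ne_zero val_natCast_fine
  sOf_cubic_congr chi_pOf_eq_phc norm_le_of_near)
open Literature.MathematicalPhysics.QuantumFieldTheory.Balaban1983to89.Beta.LongitudinalWindow (cTAt bAt lamp fsum Lker
  Lker_eq_fsum cTAt_of_ne bAt_of_ne fibre_term_lamp_le Δ₀_fiberAt_le legC legC_nonneg ellD0 ellD1 ellD2 norm_Lker_le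
  norm_Lker_sub_left_le norm_Lker_sub_right_le norm_Lker_sub_sub_le)
open Literature.Probability.LatticeModels (brillouin dispersion TorusSite latticeMomentum continuous_dispersion
  dispersion_add_int_mul)
open Literature.MathematicalPhysics.QuantumFieldTheory.Balaban1983to89.Beta.PuncturedRiemannSum
  (momentumAverage_punctured_approx)

variable {d : ℕ} (n : ℕ) [NeZero n]

/-! ## §0 The continuum fibre functions of line 3 of (1.83) -/

/-- `X(θ) = Σ_l |u(θ+l)|²/Δ(θ+l)²`. [cite: Balaban1984PropagatorsI, (1.83) p.31] -/
noncomputable def Xc (θ : Fin d → ℝ) : ℝ := ∑ k : Fin d → Fin n, ‖uSym n k θ‖ ^ 2 / sig n 0 k θ ^ 2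

/-- `φ_μ(θ) = 1 + a Σ_l |u v_μ|²(θ+l)/Δ(θ+l)`. [cite: Balaban1984PropagatorsI, (1.83) p.31] -/
noncomputable def phic (a : ℝ) (μ : Fin d) (θ : Fin d → ℝ) : ℝ :=
  1 + a * ∑ k : Fin d → Fin n, ‖uSym n k θ * vSym n k θ μ‖ ^ 2 / sig n 0 k θ

/-- `Φ(θ) = Σ_μ |∂¹_μ(θ)|²/φ_μ(θ)`. [cite: Balaban1984PropagatorsI, (1.83) p.31] -/
noncomputable def Phic (a : ℝ) (θ : Fin d → ℝ) : ℝ := ∑ μ, ‖d1Sym θ μ‖ ^ 2 / phic n a μ θ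

/-- `cT(θ) = a⁻¹ Φ(θ)⁻¹` (`= 0` on `(2πℤ)^d`, where `Φ = 0`). [cite: Balaban1984PropagatorsI, (1.83) p.31] -/
noncomputable def cTc (a : ℝ) (θ : Fin d → ℝ) : ℂ := 1 / ((a : ℂ) * (Phic n a θ : ℂ))

/-- the square bracket `b(l,μ)(θ)` of (1.83). [cite: Balaban1984PropagatorsI, (1.83) p.31] -/
noncomputable def bc (a : ℝ) (k : Fin d → Fin n) (μ : Fin d) (θ : Fin d → ℝ) : ℂ :=
  dSym n k θ μ * conj (uSym n k θ) / (((sig n 0 k θ : ℝ) : ℂ) ^ 2 * (Xc n θ : ℂ))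
    - (a : ℂ) * conj (uSym n k θ * vSym n k θ μ) * d1Sym θ μ / ((phic n a μ θ : ℂ) * ((sig n 0 k θ : ℝ) : ℂ))

/-- the continuum LEG AMPLITUDE `β(θ; x, μ) = Σ_l (Π_ν ω_ν^{x_ν}) b(l,μ)(θ)` at an integer point `x`. [folklore] -/
noncomputable def lampc (a : ℝ) (θ : Fin d → ℝ) (x : Fin d → ℕ) (μ : Fin d) : ℂ :=
  ∑ k : Fin d → Fin n, phc n k θ x * bc n a k μ θ

/-- THE CONTINUUM SYMBOL OF LINE 3: `F_𝓛(θ; (x,μ),(x′,ν)) = cT(θ) β(θ;x,μ) conj β(θ;x′,ν)`. [folklore] -/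
noncomputable def FL (a : ℝ) (x : Fin d → ℕ) (μ : Fin d) (x' : Fin d → ℕ) (ν : Fin d) (θ : Fin d → ℝ) : ℂ :=
  cTc n a θ * (lampc n a θ x μ * conj (lampc n a θ x' ν))

omit [NeZero n] in
/-- `∂¹_μ(0) = 0`, hence `Φ(0) = 0`. [folklore] -/
theorem Phic_zero (a : ℝ) : Phic n a (0 : Fin d → ℝ) = 0 := by
  simp [Phic, d1Sym]

omit [NeZero n] in
/-- `cT(0) = 0` (Lean's `1/0 = 0`; line 3 of (1.83) has no zero mode). [folklore] -/
theorem cTc_zero (a : ℝ) : cTc n a (0 : Fin d → ℝ) = 0 := by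
  simp [cTc, Phic_zero]

omit [NeZero n] in
/-- `F_𝓛(0) = 0`. [folklore] -/
theorem FL_zero (a : ℝ) (x : Fin d → ℕ) (μ : Fin d) (x' : Fin d → ℕ) (ν : Fin d) : FL n a x μ x' ν 0 = 0 := by
  unfold FL
  rw [cTc_zero, zero_mul]

/-! ## §1 Identification with the torus fibre objects of `LongitudinalWindow` -/

/-- the continuum fibre's `cT` is `cT(θ)`. [folklore] -/
theorem balabanFiber_cT (hn : 1 ≤ n) (a : ℝ) (ha : 0 < a) (s : Fin d → ℝ) (hs : ∀ μ, |s μ| ≤ π) (hs0 : s ≠ 0) :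
    (balabanFiber n hn a ha s hs hs0).cT = cTc n a s := rfl

/-- the continuum fibre's `b(l,μ)` is `b(l,μ)(θ)`. [folklore] -/
theorem balabanFiber_b (hn : 1 ≤ n) (a : ℝ) (ha : 0 < a) (s : Fin d → ℝ) (hs : ∀ μ, |s μ| ≤ π) (hs0 : s ≠ 0)
    (k : Fin d → Fin n) (μ : Fin d) : (balabanFiber n hn a ha s hs hs0).b k μ = bc n a k μ s := rfl

/-- the continuum fibre's `X` is `X(θ)`. [folklore] -/
theorem balabanFiber_X (hn : 1 ≤ n) (a : ℝ) (ha : 0 < a) (s : Fin d → ℝ) (hs : ∀ μ, |s μ| ≤ π) (hs0 : s ≠ 0) :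
    (balabanFiber n hn a ha s hs hs0).X = Xc n s := rfl

/-- the continuum fibre's `Φ` is `Φ(θ)`. [folklore] -/
theorem balabanFiber_Φ (hn : 1 ≤ n) (a : ℝ) (ha : 0 < a) (s : Fin d → ℝ) (hs : ∀ μ, |s μ| ≤ π) (hs0 : s ≠ 0) :
    (balabanFiber n hn a ha s hs hs0).Φ = Phic n a s := rfl

section Torus

variable (hn : 1 ≤ n) (M : Fin d → ℕ) [∀ μ, NeZero (M μ)] (a : ℝ) (ha : 0 < a)

/-- `cT` of the torus fibre at `q ≠ 0` is `cT(sOf q)`. [folklore] -/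
theorem fiberAt_cT {q : Tor M} (hq : q ≠ 0) : (B5FiberQQ.fiberAt n M hn a ha q hq).cT = cTc n a (sOf M q) := rfl

/-- `b(l,μ)` of the torus fibre at `q ≠ 0` is `b(l,μ)(sOf q)`. [folklore] -/
theorem fiberAt_b {q : Tor M} (hq : q ≠ 0) (k : Fin d → Fin n) (μ : Fin d) :
    (B5FiberQQ.fiberAt n M hn a ha q hq).b k μ = bc n a k μ (sOf M q) := rfl

/-- **`cTAt q = cT(sOf q)` FOR EVERY CLASS** (at `q = 0` both sides are `0`). [folklore] -/
theorem cTAt_eq (q : Tor M) : cTAt n hn M a ha q = cTc n a (sOf M q) := by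
  by_cases hq : q = 0
  · subst hq
    rw [sOf_zero, cTc_zero]
    simp [cTAt]
  · rw [cTAt_of_ne n hn M a ha hq]
    rfl

/-- the torus leg amplitude at `q ≠ 0` is the continuum one at `θ = sOf q`. [folklore] -/
theorem lamp_eq_lampc {q : Tor M} (hq : q ≠ 0) (x : Tor (fine n M)) (μ : Fin d) :
    lamp n hn M a ha q x μ = lampc n a (sOf M q) (fun ν => (x ν).val) μ := by
  unfold lamp lampc
  refine Finset.sum_congr rfl fun k _ => ?_
  rw [chi_pOf_eq_phc, bAt_of_ne n hn M a ha hq, fiberAt_b]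

/-- **THE TORUS FIBRE TERM IS THE CONTINUUM SYMBOL AT `θ = sOf q`**, for every class `q`. [folklore] -/
theorem fibreTerm_eq_FL (q : Tor M) (x : Tor (fine n M)) (μ : Fin d) (x' : Tor (fine n M)) (ν : Fin d) :
    cTAt n hn M a ha q * (lamp n hn M a ha q x μ * conj (lamp n hn M a ha q x' ν))
      = FL n a (fun ρ => (x ρ).val) μ (fun ρ => (x' ρ).val) ν (sOf M q) := by
  by_cases hq : q = 0
  · subst hq
    rw [sOf_zero, FL_zero]
    simp [cTAt]
  · unfold FL
    rw [cTAt_eq, lamp_eq_lampc n hn M a ha hq, lamp_eq_lampc n hn M a ha hq]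

/-- **`𝓛 = |T|⁻¹ Σ_{q ∈ T} F_𝓛(sOf q)`** — the line-3 kernel is a FULL coarse-momentum sum of its continuum symbol.
[folklore] -/
theorem Lker_eq_sum_FL (x : Tor (fine n M)) (μ : Fin d) (x' : Tor (fine n M)) (ν : Fin d) :
    Lker n hn M a ha x μ x' ν = ((Fintype.card (Tor (fine n M)) : ℂ))⁻¹ *
      ∑ q : Tor M, FL n a (fun ρ => (x ρ).val) μ (fun ρ => (x' ρ).val) ν (sOf M q) := by
  rw [Lker_eq_fsum]
  unfold fsum
  congr 1
  exact Finset.sum_congr rfl fun q _ => fibreTerm_eq_FL n hn M a ha q x μ x' ν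

end Torus

/-! ## §2 `2π`-periodicity -/

/-- `∂_μ` is alias-covariant: `∂_μ(k, θ + 2πz) = ∂_μ((k+z) mod n, θ)`. [folklore] -/
theorem dSym_shift (z : Fin d → ℤ) (k : Fin d → Fin n) (θ : Fin d → ℝ) (μ : Fin d) :
    dSym n k (fun ν => θ ν + 2 * π * (z ν : ℝ)) μ = dSym n (kshift n z k) θ μ := by
  rw [dSym_eq_om, dSym_eq_om, om_shift]

omit [NeZero n] in
/-- `∂¹_μ` is `2π`-periodic. [folklore] -/
theorem d1Sym_shift (z : Fin d → ℤ) (θ : Fin d → ℝ) (μ : Fin d) :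
    d1Sym (fun ν => θ ν + 2 * π * (z ν : ℝ)) μ = d1Sym θ μ := by
  simp only [d1Sym]
  rw [Complex.ofReal_add, add_mul, Complex.exp_add]
  have h1 : Complex.exp (((2 * π * (z μ : ℝ) : ℝ) : ℂ) * Complex.I) = 1 := by
    have := Complex.exp_int_mul_two_pi_mul_I (z μ)
    rw [← this]
    congr 1
    push_cast
    ring
  rw [h1, mul_one]

/-- `v_μ` is alias-covariant. [folklore] -/
theorem vSym_shift (z : Fin d → ℤ) (k : Fin d → Fin n) (θ : Fin d → ℝ) (μ : Fin d) :
    vSym n k (fun ν => θ ν + 2 * π * (z ν : ℝ)) μ = vSym n (kshift n z k) θ μ := by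
  simp only [vSym, dSym_shift, d1Sym_shift]

/-- `u` is alias-covariant. [folklore] -/
theorem uSym_shift (z : Fin d → ℤ) (k : Fin d → Fin n) (θ : Fin d → ℝ) :
    uSym n k (fun ν => θ ν + 2 * π * (z ν : ℝ)) = uSym n (kshift n z k) θ := by
  unfold uSym
  simp_rw [vSym_shift]

/-- `X` is `2π`-periodic. [folklore] -/
theorem Xc_periodic (θ : Fin d → ℝ) (z : Fin d → ℤ) : Xc n (fun ν => θ ν + 2 * π * (z ν : ℝ)) = Xc n θ := by
  unfold Xc
  simp_rw [uSym_shift, sig_shift]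
  exact Fintype.sum_bijective (kshift n z) ((Finite.injective_iff_bijective).mp (kshift_injective n z)) _ _
    fun k => rfl

/-- `φ_μ` is `2π`-periodic. [folklore] -/
theorem phic_periodic (a : ℝ) (μ : Fin d) (θ : Fin d → ℝ) (z : Fin d → ℤ) :
    phic n a μ (fun ν => θ ν + 2 * π * (z ν : ℝ)) = phic n a μ θ := by
  unfold phic
  simp_rw [uSym_shift, vSym_shift, sig_shift]
  congr 2
  exact Fintype.sum_bijective (kshift n z) ((Finite.injective_iff_bijective).mp (kshift_injective n z)) _ _
    fun k => rfl

/-- `Φ` is `2π`-periodic. [folklore] -/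
theorem Phic_periodic (a : ℝ) (θ : Fin d → ℝ) (z : Fin d → ℤ) :
    Phic n a (fun ν => θ ν + 2 * π * (z ν : ℝ)) = Phic n a θ := by
  unfold Phic
  simp_rw [d1Sym_shift, phic_periodic]

/-- `cT` is `2π`-periodic. [folklore] -/
theorem cTc_periodic (a : ℝ) (θ : Fin d → ℝ) (z : Fin d → ℤ) :
    cTc n a (fun ν => θ ν + 2 * π * (z ν : ℝ)) = cTc n a θ := by
  unfold cTc
  rw [Phic_periodic]

/-- `b(l,μ)` is alias-covariant. [folklore] -/
theorem bc_shift (a : ℝ) (z : Fin d → ℤ) (k : Fin d → Fin n) (μ : Fin d) (θ : Fin d → ℝ) :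
    bc n a k μ (fun ν => θ ν + 2 * π * (z ν : ℝ)) = bc n a (kshift n z k) μ θ := by
  unfold bc
  rw [dSym_shift, uSym_shift, vSym_shift, d1Sym_shift, sig_shift, Xc_periodic, phic_periodic]

/-- the leg amplitude is `2π`-periodic (integer `x`). [folklore] -/
theorem lampc_periodic (a : ℝ) (x : Fin d → ℕ) (μ : Fin d) (θ : Fin d → ℝ) (z : Fin d → ℤ) :
    lampc n a (fun ν => θ ν + 2 * π * (z ν : ℝ)) x μ = lampc n a θ x μ := by
  unfold lampc
  simp_rw [phc_shift, bc_shift]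
  exact Fintype.sum_bijective (kshift n z) ((Finite.injective_iff_bijective).mp (kshift_injective n z)) _ _
    fun k => rfl

/-- **THE SYMBOL `F_𝓛` IS `2π`-PERIODIC** in every coordinate of `θ`. [folklore] -/
theorem FL_periodic (a : ℝ) (x : Fin d → ℕ) (μ : Fin d) (x' : Fin d → ℕ) (ν : Fin d) (θ : Fin d → ℝ)
    (z : Fin d → ℤ) : FL n a x μ x' ν (fun ρ => θ ρ + 2 * π * (z ρ : ℝ)) = FL n a x μ x' ν θ := by
  unfold FL
  rw [cTc_periodic, lampc_periodic, lampc_periodic]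

/-! ## §3 Continuity off the resonant set `(2πℤ)^d` -/

/-- **`v_μ` IS THE GEOMETRIC MEAN `n⁻¹ Σ_{j<n} ω_μ^j`** (`ω_μ = e^{i(θ_μ+2πk_μ)/n}`): both branches of its
definition (`∂¹/∂` and the value `1` at the removable singularity) agree with it. [folklore] -/
theorem vSym_eq_geom (k : Fin d → Fin n) (θ : Fin d → ℝ) (μ : Fin d) :
    vSym n k θ μ = ((n : ℂ))⁻¹ * ∑ j : Fin n, om n k θ μ ^ (j : ℕ) := by
  have hn0 : (n : ℂ) ≠ 0 := by exact_mod_cast NeZero.ne n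
  have hd1 : d1Sym θ μ = om n k θ μ ^ n - 1 := by
    rw [om_pow]
    rfl
  rw [Fin.sum_univ_eq_sum_range (fun j => om n k θ μ ^ j) n]
  unfold vSym
  by_cases h : dSym n k θ μ = 0
  · have h' := h
    rw [dSym_eq_om] at h'
    have hom : om n k θ μ = 1 := sub_eq_zero.mp ((mul_eq_zero.mp h').resolve_left hn0)
    rw [if_pos h, hom]
    simp [hn0]
  · have hom : om n k θ μ ≠ 1 := fun h1 => h (by rw [dSym_eq_om, h1, sub_self, mul_zero])
    have hom' : om n k θ μ - 1 ≠ 0 := sub_ne_zero.mpr hom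
    rw [if_neg h, geom_sum_eq hom, dSym_eq_om, hd1]
    field_simp

omit [NeZero n] in
/-- `∂_μ(k, ·)` is continuous. [folklore] -/
theorem continuous_dSym (k : Fin d → Fin n) (μ : Fin d) : Continuous fun θ : Fin d → ℝ => dSym n k θ μ := by
  simp_rw [dSym_eq_om]
  exact continuous_const.mul ((continuous_om n k μ).sub continuous_const)

omit [NeZero n] in
/-- `∂¹_μ` is continuous. [folklore] -/
theorem continuous_d1Sym (μ : Fin d) : Continuous fun θ : Fin d → ℝ => d1Sym θ μ := by
  unfold d1Sym
  exact (Complex.continuous_exp.comp ((Complex.continuous_ofReal.comp (continuous_apply μ)).mul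
    continuous_const)).sub continuous_const

/-- `v_μ(k, ·)` is continuous (a trigonometric polynomial). [folklore] -/
theorem continuous_vSym (k : Fin d → Fin n) (μ : Fin d) : Continuous fun θ : Fin d → ℝ => vSym n k θ μ := by
  have h : (fun θ : Fin d → ℝ => vSym n k θ μ) = fun θ => ((n : ℂ))⁻¹ * ∑ j : Fin n, om n k θ μ ^ (j : ℕ) :=
    funext fun θ => vSym_eq_geom n k θ μ
  rw [h]
  exact continuous_const.mul (continuous_finsetSum _ fun j _ => (continuous_om n k μ).pow _)

/-- `u(k, ·)` is continuous. [folklore] -/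
theorem continuous_uSym (k : Fin d → Fin n) : Continuous fun θ : Fin d → ℝ => uSym n k θ := by
  unfold uSym
  exact continuous_finsetProd _ fun μ _ => continuous_vSym n k μ

/-- `φ_μ > 0` off the resonant set (`a ≥ 0`). [folklore] -/
theorem phic_pos {a : ℝ} (ha : 0 ≤ a) (μ : Fin d) {θ : Fin d → ℝ} (hθ : θ ∈ nonRes d) : 0 < phic n a μ θ := by
  unfold phic
  have hS : 0 ≤ ∑ k : Fin d → Fin n, ‖uSym n k θ * vSym n k θ μ‖ ^ 2 / sig n 0 k θ :=
    Finset.sum_nonneg fun k _ => div_nonneg (sq_nonneg _) (sig_pos n le_rfl k hθ).le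
  nlinarith [mul_nonneg ha hS]

/-- the integer vector nearest to `θ/2π`. [folklore] -/
noncomputable def rnd (θ : Fin d → ℝ) : Fin d → ℤ := fun ν => round (θ ν / (2 * π))

/-- REDUCTION INTO THE ZONE: `θ − 2π·rnd(θ) ∈ [-π,π]^d`. [folklore] -/
noncomputable def red (θ : Fin d → ℝ) : Fin d → ℝ := fun ν => θ ν - 2 * π * (rnd θ ν : ℝ)

omit [NeZero n] in
/-- `θ = red θ + 2π rnd θ`. [folklore] -/
theorem red_add (θ : Fin d → ℝ) : (fun ν => red θ ν + 2 * π * (rnd θ ν : ℝ)) = θ :=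
  funext fun ν => by simp [red]

omit [NeZero n] in
/-- `|red θ_ν| ≤ π`. [folklore] -/
theorem abs_red_le (θ : Fin d → ℝ) (ν : Fin d) : |red θ ν| ≤ π := by
  have h := abs_sub_round (θ ν / (2 * π))
  have hπ : 0 < 2 * π := by positivity
  have heq : red θ ν = (2 * π) * (θ ν / (2 * π) - round (θ ν / (2 * π))) := by
    have h2 : (2 * π) * (θ ν / (2 * π)) = θ ν := by field_simp
    simp only [red, rnd]
    rw [mul_sub, h2]
  rw [heq, abs_mul, abs_of_pos hπ]
  calc 2 * π * |θ ν / (2 * π) - round (θ ν / (2 * π))| ≤ 2 * π * (1 / 2) := by gcongr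
    _ = π := by ring

omit [NeZero n] in
/-- a non-resonant `θ` reduces to a NONZERO point of the zone. [folklore] -/
theorem red_ne_zero {θ : Fin d → ℝ} (hθ : θ ∈ nonRes d) : red θ ≠ 0 := by
  intro h
  have hcos : ∀ ν, Real.cos (θ ν) = 1 := fun ν => by
    have hν := congr_fun h ν
    simp only [red, Pi.zero_apply] at hν
    have : θ ν = (rnd θ ν : ℝ) * (2 * π) := by linarith
    rw [this, Real.cos_int_mul_two_pi]
  have h0 : dispersion θ = 0 := by
    unfold dispersion
    exact Finset.sum_eq_zero fun ν _ => by rw [hcos ν]; ring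
  have hpos : (0 : ℝ) < dispersion θ := hθ
  rw [h0] at hpos
  exact lt_irrefl _ hpos

/-- **`X(θ) > 0` off the resonant set** (the tree's `Fiber.X_pos` at the reduced point, and periodicity). [folklore] -/
theorem Xc_pos (hn : 1 ≤ n) {θ : Fin d → ℝ} (hθ : θ ∈ nonRes d) : 0 < Xc n θ := by
  have hper : Xc n θ = Xc n (red θ) := by
    have := Xc_periodic n (red θ) (rnd θ)
    rwa [red_add] at this
  rw [hper]
  exact (balabanFiber n hn 1 one_pos (red θ) (abs_red_le θ) (red_ne_zero hθ)).X_pos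

/-- **`Φ(θ) > 0` off the resonant set** (`a > 0`; the tree's `Fiber.Φ_pos` at the reduced point). [folklore] -/
theorem Phic_pos (hn : 1 ≤ n) {a : ℝ} (ha : 0 < a) {θ : Fin d → ℝ} (hθ : θ ∈ nonRes d) : 0 < Phic n a θ := by
  have hper : Phic n a θ = Phic n a (red θ) := by
    have := Phic_periodic n a (red θ) (rnd θ)
    rwa [red_add] at this
  rw [hper]
  exact (balabanFiber n hn a ha (red θ) (abs_red_le θ) (red_ne_zero hθ)).Φ_pos

/-- `X` is continuous on the non-resonant set. [folklore] -/
theorem continuousOn_Xc : ContinuousOn (Xc n) (nonRes d) := by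
  unfold Xc
  refine continuousOn_finsetSum _ fun k _ => ?_
  exact ContinuousOn.div (((continuous_uSym n k).norm).pow 2).continuousOn
    ((continuous_sig n 0 k).pow 2).continuousOn fun θ hθ => pow_ne_zero 2 (sig_pos n le_rfl k hθ).ne'

/-- `φ_μ` is continuous on the non-resonant set. [folklore] -/
theorem continuousOn_phic (a : ℝ) (μ : Fin d) : ContinuousOn (phic n a μ) (nonRes d) := by
  unfold phic
  refine continuousOn_const.add (continuousOn_const.mul (continuousOn_finsetSum _ fun k _ => ?_))
  exact ContinuousOn.div ((((continuous_uSym n k).mul (continuous_vSym n k μ)).norm).pow 2).continuousOn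
    (continuous_sig n 0 k).continuousOn fun θ hθ => (sig_pos n le_rfl k hθ).ne'

/-- `Φ` is continuous on the non-resonant set (`a ≥ 0`). [folklore] -/
theorem continuousOn_Phic {a : ℝ} (ha : 0 ≤ a) : ContinuousOn (Phic n a) (nonRes d) := by
  unfold Phic
  refine continuousOn_finsetSum _ fun μ _ => ?_
  exact ContinuousOn.div (((continuous_d1Sym μ).norm).pow 2).continuousOn (continuousOn_phic n a μ)
    fun θ hθ => (phic_pos n ha μ hθ).ne'

/-- `cT` is continuous on the non-resonant set (`a > 0`). [folklore] -/
theorem continuousOn_cTc (hn : 1 ≤ n) {a : ℝ} (ha : 0 < a) : ContinuousOn (cTc n a) (nonRes d) := by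
  unfold cTc
  refine ContinuousOn.div continuousOn_const
    (continuousOn_const.mul (Complex.continuous_ofReal.comp_continuousOn (continuousOn_Phic n ha.le))) fun θ hθ => ?_
  have h1 : (a : ℂ) ≠ 0 := by exact_mod_cast ha.ne'
  have h2 : ((Phic n a θ : ℝ) : ℂ) ≠ 0 := by exact_mod_cast (Phic_pos n hn ha hθ).ne'
  exact mul_ne_zero h1 h2

/-- `b(l,μ)` is continuous on the non-resonant set (`a > 0`). [folklore] -/
theorem continuousOn_bc (hn : 1 ≤ n) {a : ℝ} (ha : 0 < a) (k : Fin d → Fin n) (μ : Fin d) :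
    ContinuousOn (bc n a k μ) (nonRes d) := by
  unfold bc
  refine ContinuousOn.sub ?_ ?_
  · refine ContinuousOn.div ((continuous_dSym n k μ).continuousOn.mul
      (Complex.continuous_conj.comp_continuousOn (continuous_uSym n k).continuousOn))
      (((Complex.continuous_ofReal.comp (continuous_sig n 0 k)).pow 2).continuousOn.mul
        (Complex.continuous_ofReal.comp_continuousOn (continuousOn_Xc n))) fun θ hθ => ?_
    have h1 : ((sig n 0 k θ : ℝ) : ℂ) ≠ 0 := by exact_mod_cast (sig_pos n le_rfl k hθ).ne'
    have h2 : ((Xc n θ : ℝ) : ℂ) ≠ 0 := by exact_mod_cast (Xc_pos n hn hθ).ne'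
    exact mul_ne_zero (pow_ne_zero 2 h1) h2
  · refine ContinuousOn.div (((continuousOn_const.mul (Complex.continuous_conj.comp_continuousOn
      ((continuous_uSym n k).mul (continuous_vSym n k μ)).continuousOn)).mul (continuous_d1Sym μ).continuousOn))
      ((Complex.continuous_ofReal.comp_continuousOn (continuousOn_phic n a μ)).mul
        (Complex.continuous_ofReal.comp (continuous_sig n 0 k)).continuousOn) fun θ hθ => ?_
    have h1 : ((phic n a μ θ : ℝ) : ℂ) ≠ 0 := by exact_mod_cast (phic_pos n ha.le μ hθ).ne'
    have h2 : ((sig n 0 k θ : ℝ) : ℂ) ≠ 0 := by exact_mod_cast (sig_pos n le_rfl k hθ).ne'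
    exact mul_ne_zero h1 h2

/-- the leg amplitude is continuous on the non-resonant set. [folklore] -/
theorem continuousOn_lampc (hn : 1 ≤ n) {a : ℝ} (ha : 0 < a) (x : Fin d → ℕ) (μ : Fin d) :
    ContinuousOn (fun θ => lampc n a θ x μ) (nonRes d) := by
  unfold lampc
  exact continuousOn_finsetSum _ fun k _ => (continuous_phc n k x).continuousOn.mul (continuousOn_bc n hn ha k μ)

/-- **THE SYMBOL `F_𝓛` IS CONTINUOUS ON THE NON-RESONANT SET.** [folklore] -/
theorem continuousOn_FL (hn : 1 ≤ n) {a : ℝ} (ha : 0 < a) (x : Fin d → ℕ) (μ : Fin d) (x' : Fin d → ℕ)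
    (ν : Fin d) : ContinuousOn (FL n a x μ x' ν) (nonRes d) := by
  unfold FL
  exact (continuousOn_cTc n hn ha).mul ((continuousOn_lampc n hn ha x μ).mul
    (Complex.continuous_conj.comp_continuousOn (continuousOn_lampc n hn ha x' ν)))

/-- … in particular on the punctured zone. [folklore] -/
theorem continuousOn_FL_brillouin (hn : 1 ≤ n) {a : ℝ} (ha : 0 < a) (x : Fin d → ℕ) (μ : Fin d)
    (x' : Fin d → ℕ) (ν : Fin d) : ContinuousOn (FL n a x μ x' ν) (brillouin d \ {0}) :=
  (continuousOn_FL n hn ha x μ x' ν).mono (brillouin_diff_subset_nonRes (d := d))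

/-! ## §4 The bounded majorant — by DENSITY from `LongitudinalWindow.fibre_term_lamp_le` -/

/-- `B_𝓛(d,a) = γ₊ L_b² a⁻¹ · 4d`. [folklore] -/
noncomputable def BL (d : ℕ) (a : ℝ) : ℝ := gammaPlus d a * legC d a * legC d a / a * (4 * d)

omit [NeZero n] in
/-- `B_𝓛 ≥ 0`. [folklore] -/
theorem BL_nonneg {a : ℝ} (ha : 0 < a) : 0 ≤ BL d a := by
  unfold BL
  have hL := legC_nonneg (d := d) ha
  have hγ : 0 ≤ gammaPlus d a := by unfold gammaPlus; positivity
  positivity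

/-- THE TORUS BOUND AT THE APPROXIMANT: `‖F_𝓛(θ_m)‖ ≤ B_𝓛` whenever `θ_m` is non-resonant and the torus of period
`n·m` holds `x, x′`. [folklore] -/
theorem norm_FL_thApprox_le (hd : 0 < d) (hn : 1 ≤ n) {a : ℝ} (ha : 0 < a) (x : Fin d → ℕ) (μ : Fin d)
    (x' : Fin d → ℕ) (ν : Fin d) {θ : Fin d → ℝ} {m : ℕ} [NeZero m] (hx : ∀ ρ, x ρ < n * m)
    (hx' : ∀ ρ, x' ρ < n * m) (hres : thApprox m θ ∈ nonRes d) :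
    ‖FL n a x μ x' ν (thApprox m θ)‖ ≤ BL d a := by
  obtain ⟨w, hw⟩ := sOf_vApprox (d := d) m θ
  have hq := vApprox_class_ne_zero (d := d) m hres
  set q : Tor (cubic d m) := fun ρ => ((vApprox m θ ρ : ℤ) : ZMod m) with hq_def
  set xm : Tor (fine n (cubic d m)) := fun ρ => ((x ρ : ℕ) : ZMod (fine n (cubic d m) ρ)) with hxm
  set xm' : Tor (fine n (cubic d m)) := fun ρ => ((x' ρ : ℕ) : ZMod (fine n (cubic d m) ρ)) with hxm'
  have hvx : (fun ρ => (xm ρ).val) = x := val_natCast_fine n hx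
  have hvx' : (fun ρ => (xm' ρ).val) = x' := val_natCast_fine n hx'
  have hid : cTAt n hn (cubic d m) a ha q * (lamp n hn (cubic d m) a ha q xm μ * conj (lamp n hn (cubic d m) a ha q xm' ν))
      = FL n a x μ x' ν (thApprox m θ) := by
    rw [fibreTerm_eq_FL, hvx, hvx', hw, FL_periodic]
  have hB := fibre_term_lamp_le n hn (cubic d m) a ha hd hq xm μ xm' ν
  rw [hid] at hB
  have hΔ := Δ₀_fiberAt_le n hn (cubic d m) a ha hq
  have hL := legC_nonneg (d := d) ha
  have hγ : 0 ≤ gammaPlus d a := by unfold gammaPlus; positivity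
  have hK : 0 ≤ gammaPlus d a * legC d a * legC d a / a := by positivity
  calc ‖FL n a x μ x' ν (thApprox m θ)‖
      ≤ gammaPlus d a * legC d a * legC d a / a * (B5FiberQQ.fiberAt n (cubic d m) hn a ha q hq).Δ₀ := hB
    _ ≤ gammaPlus d a * legC d a * legC d a / a * (4 * d) := mul_le_mul_of_nonneg_left hΔ hK
    _ = BL d a := rfl

/-- **THE MAJORANT ON THE NON-RESONANT SET**: `‖F_𝓛(θ)‖ ≤ B_𝓛` — by density (`θ_m → θ`, continuity of §3). [folklore] -/
theorem norm_FL_le (hd : 0 < d) (hn : 1 ≤ n) {a : ℝ} (ha : 0 < a) (x : Fin d → ℕ) (μ : Fin d) (x' : Fin d → ℕ)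
    (ν : Fin d) {θ : Fin d → ℝ} (hθ : θ ∈ nonRes d) : ‖FL n a x μ x' ν θ‖ ≤ BL d a := by
  have hT := tendsto_thApprox (d := d) θ
  have hcont : ContinuousAt (FL n a x μ x' ν) θ :=
    (continuousOn_FL n hn ha x μ x' ν).continuousAt ((isOpen_nonRes d).mem_nhds hθ)
  have hg : Tendsto (fun m : ℕ => ‖FL n a x μ x' ν (thApprox m θ)‖) atTop (𝓝 ‖FL n a x μ x' ν θ‖) :=
    (hcont.tendsto.comp hT).norm
  have hres : ∀ᶠ m : ℕ in atTop, thApprox m θ ∈ nonRes d := hT.eventually ((isOpen_nonRes d).mem_nhds hθ)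
  set m₀ : ℕ := univ.sup x + univ.sup x' + 1 with hm₀
  have hev : ∀ᶠ m : ℕ in atTop, ‖FL n a x μ x' ν (thApprox m θ)‖ ≤ BL d a := by
    filter_upwards [hres, eventually_ge_atTop m₀] with m hm hmm₀
    haveI : NeZero m := ⟨by omega⟩
    have hnm : m ≤ n * m := Nat.le_mul_of_pos_left m (by omega)
    have hx : ∀ ρ, x ρ < n * m := fun ρ => by
      have h1 : x ρ ≤ univ.sup x := Finset.le_sup (mem_univ ρ)
      omega
    have hx' : ∀ ρ, x' ρ < n * m := fun ρ => by
      have h1 : x' ρ ≤ univ.sup x' := Finset.le_sup (mem_univ ρ)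
      omega
    exact norm_FL_thApprox_le n hd hn ha x μ x' ν hx hx' hm
  exact le_of_tendsto hg hev

/-- … on the WHOLE zone (at `θ = 0` the symbol vanishes): the hypothesis shape of `PuncturedRiemannSum`. [folklore] -/
theorem norm_FL_le_of_mem_brillouin (hd : 0 < d) (hn : 1 ≤ n) {a : ℝ} (ha : 0 < a) (x : Fin d → ℕ) (μ : Fin d)
    (x' : Fin d → ℕ) (ν : Fin d) (θ : Fin d → ℝ) (hθ : θ ∈ brillouin d) : ‖FL n a x μ x' ν θ‖ ≤ BL d a := by
  by_cases h0 : θ = 0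
  · subst h0
    rw [FL_zero, norm_zero]
    exact BL_nonneg ha
  · exact norm_FL_le n hd hn ha x μ x' ν (brillouin_diff_subset_nonRes (d := d) ⟨hθ, h0⟩)

/-! ## §5 Cubic tori: `N^d 𝓛` is a momentum average of the symbol, and its limit `T ↗ ℤ^d` -/

/-- **ON A CUBIC TORUS `N^d 𝓛((x,μ),(x′,ν)) = m^{-d} Σ_{k ∈ (ℤ/m)^d} F_𝓛(2πk/m; (x,μ),(x′,ν))`.** [folklore] -/
theorem Lker_cubic_eq (hn : 1 ≤ n) (a : ℝ) (ha : 0 < a) (m : ℕ) [NeZero m] (x : Tor (fine n (cubic d m)))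
    (μ : Fin d) (x' : Tor (fine n (cubic d m))) (ν : Fin d) :
    ((n : ℂ) ^ d) * Lker n hn (cubic d m) a ha x μ x' ν =
      (((m ^ d : ℕ) : ℝ)⁻¹) • ∑ k : TorusSite d m,
        FL n a (fun ρ => (x ρ).val) μ (fun ρ => (x' ρ).val) ν (latticeMomentum m k) := by
  rw [Lker_eq_sum_FL, card_tor_fine_cubic]
  have hsum : ∑ q : Tor (cubic d m), FL n a (fun ρ => (x ρ).val) μ (fun ρ => (x' ρ).val) ν (sOf (cubic d m) q)
      = ∑ k : TorusSite d m, FL n a (fun ρ => (x ρ).val) μ (fun ρ => (x' ρ).val) ν (latticeMomentum m k) := by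
    refine Finset.sum_congr rfl fun q _ => ?_
    obtain ⟨w, hw⟩ := sOf_cubic_congr (d := d) m q
    rw [hw, FL_periodic]
  rw [hsum, Complex.real_smul, ← mul_assoc]
  congr 1
  have hn0 : (n : ℂ) ≠ 0 := by exact_mod_cast NeZero.ne n
  push_cast
  rw [mul_pow, mul_inv, ← mul_assoc, mul_inv_cancel₀ (pow_ne_zero d hn0), one_mul]

/-- **THE INFINITE-VOLUME LIMIT OF THE LONGITUDINAL KERNEL ALONG THE CUBIC TORI** (EVERY `d ≥ 1`, `n ≥ 1`, `a > 0`;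
even coarse periods `m → ∞`, fixed integer points): `‖N^d 𝓛_{N,(m,…,m)}((x̂,μ),(x̂′,ν)) − (2π)^{-d}∫_{[-π,π]^d} F_𝓛 dθ‖ ≤ ε`
for all even `m ≥ m₀(ε)`. This is the `T^{(j+1)} ↗ ℤ^d` step of B12 p. 264 for line 3 of (1.83). [folklore] -/
theorem Lker_tendsto_infiniteVolume (hd : 0 < d) (hn : 1 ≤ n) {a : ℝ} (ha : 0 < a) (x : Fin d → ℕ) (μ : Fin d)
    (x' : Fin d → ℕ) (ν : Fin d) {ε : ℝ} (hε : 0 < ε) :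
    ∃ m₀ : ℕ, ∀ (m : ℕ) [NeZero m], Even m → m₀ ≤ m →
      ‖((n : ℂ) ^ d) * Lker n hn (cubic d m) a ha (fun ρ => ((x ρ : ℕ) : ZMod (fine n (cubic d m) ρ))) μ
            (fun ρ => ((x' ρ : ℕ) : ZMod (fine n (cubic d m) ρ))) ν
          - (((2 * π) ^ d)⁻¹ : ℝ) • ∫ θ in brillouin d, FL n a x μ x' ν θ‖ ≤ ε := by
  obtain ⟨L₁, hL₁⟩ := momentumAverage_punctured_approx (E := ℂ) hd (continuousOn_FL_brillouin n hn ha x μ x' ν)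
    (fun θ hθ => norm_FL_le_of_mem_brillouin n hd hn ha x μ x' ν θ hθ) (FL_periodic n a x μ x' ν) hε
  refine ⟨max L₁ (univ.sup x + univ.sup x' + 1), fun m _ hev hm => ?_⟩
  have hm₁ : L₁ ≤ m := le_trans (le_max_left _ _) hm
  have hm₂ : univ.sup x + univ.sup x' + 1 ≤ m := le_trans (le_max_right _ _) hm
  have hnm : m ≤ n * m := Nat.le_mul_of_pos_left m (by omega)
  have hx : ∀ ρ, x ρ < n * m := fun ρ => by
    have h1 : x ρ ≤ univ.sup x := Finset.le_sup (mem_univ ρ)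
    omega
  have hx' : ∀ ρ, x' ρ < n * m := fun ρ => by
    have h1 : x' ρ ≤ univ.sup x' := Finset.le_sup (mem_univ ρ)
    omega
  rw [Lker_cubic_eq, val_natCast_fine n hx, val_natCast_fine n hx']
  exact hL₁ m hev hm₁

/-! ## §6 The limit kernel `𝓛_∞` and the transfer of the window-grade package of `LongitudinalWindow` -/

/-- **THE INFINITE-VOLUME LONGITUDINAL KERNEL** `𝓛_∞((x,μ),(x′,ν)) := N^{-d}(2π)^{-d}∫_{[-π,π]^d} F_𝓛 dθ` on integer
points. [folklore] -/
noncomputable def LkerLim (a : ℝ) (x : Fin d → ℕ) (μ : Fin d) (x' : Fin d → ℕ) (ν : Fin d) : ℂ :=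
  ((n : ℂ) ^ d)⁻¹ * ((((2 * π) ^ d)⁻¹ : ℝ) • ∫ θ in brillouin d, FL n a x μ x' ν θ)

omit [NeZero n] in
/-- the torus point `x̂ ∈ Π_ρ ℤ/(n·m)` of an integer point `x`, shifted by `e_ρ`, is `(x + e_ρ)^`. [folklore] -/
theorem natPt_add_single (m : ℕ) (ρ : Fin d) (x : Fin d → ℕ) :
    (fun ρ' => (((x + Pi.single ρ (1 : ℕ) : Fin d → ℕ) ρ' : ℕ) : ZMod (fine n (cubic d m) ρ'))) =
      (fun ρ' => ((x ρ' : ℕ) : ZMod (fine n (cubic d m) ρ'))) + unitVec (fine n (cubic d m)) ρ := by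
  funext ρ'
  by_cases h : ρ' = ρ
  · subst h
    simp [unitVec, Pi.single_eq_same]
  · simp [unitVec, Pi.single_eq_of_ne h]

omit [NeZero n] in
/-- a positive even period beyond any threshold. [folklore] -/
theorem exists_pos_even_ge (m₀ : ℕ) : ∃ m : ℕ, 0 < m ∧ Even m ∧ m₀ ≤ m :=
  ⟨2 * (m₀ + 1), by omega, ⟨m₀ + 1, by omega⟩, by omega⟩

/-- **`𝓛 → 𝓛_∞` ENTRYWISE ALONG THE EVEN CUBIC TORI** (every `d ≥ 1`). [folklore] -/
theorem Lker_tendsto_LkerLim (hd : 0 < d) (hn : 1 ≤ n) {a : ℝ} (ha : 0 < a) (x : Fin d → ℕ) (μ : Fin d)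
    (x' : Fin d → ℕ) (ν : Fin d) {ε : ℝ} (hε : 0 < ε) :
    ∃ m₀ : ℕ, ∀ (m : ℕ) [NeZero m], Even m → m₀ ≤ m →
      ‖Lker n hn (cubic d m) a ha (fun ρ => ((x ρ : ℕ) : ZMod (fine n (cubic d m) ρ))) μ
          (fun ρ => ((x' ρ : ℕ) : ZMod (fine n (cubic d m) ρ))) ν - LkerLim n a x μ x' ν‖ ≤ ε := by
  have hn0 : (n : ℂ) ≠ 0 := by exact_mod_cast NeZero.ne n
  have hnC : ((n : ℂ) ^ d) ≠ 0 := pow_ne_zero d hn0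
  have hnR : (0 : ℝ) < (n : ℝ) := by exact_mod_cast (show 0 < n by omega)
  obtain ⟨m₀, hm₀⟩ := Lker_tendsto_infiniteVolume n hd hn ha x μ x' ν (ε := ε * (n : ℝ) ^ d) (by positivity)
  refine ⟨m₀, fun m _ hev hm => ?_⟩
  have h := hm₀ m hev hm
  set R := Lker n hn (cubic d m) a ha (fun ρ => ((x ρ : ℕ) : ZMod (fine n (cubic d m) ρ))) μ
    (fun ρ => ((x' ρ : ℕ) : ZMod (fine n (cubic d m) ρ))) ν with hR
  have key : R - LkerLim n a x μ x' ν
      = ((n : ℂ) ^ d)⁻¹ * (((n : ℂ) ^ d) * R - ((((2 * π) ^ d)⁻¹ : ℝ) • ∫ θ in brillouin d, FL n a x μ x' ν θ)) := by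
    unfold LkerLim
    rw [mul_sub, ← mul_assoc, inv_mul_cancel₀ hnC, one_mul]
  rw [key, norm_mul, norm_inv, norm_pow, Complex.norm_natCast]
  calc ((n : ℝ) ^ d)⁻¹ * ‖((n : ℂ) ^ d) * R - ((((2 * π) ^ d)⁻¹ : ℝ) • ∫ θ in brillouin d, FL n a x μ x' ν θ)‖
      ≤ ((n : ℝ) ^ d)⁻¹ * (ε * (n : ℝ) ^ d) := by gcongr
    _ = ε := by field_simp

omit [NeZero n] in
/-- transfer of a DIFFERENCE: `‖R₁ − L₁‖ ≤ ε₁`, `‖R₂ − L₂‖ ≤ ε₂` ⇒ `‖(R₁ − R₂) − (L₁ − L₂)‖ ≤ ε₁ + ε₂`. [folklore] -/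
theorem norm_sub_sub_le_of_near {R₁ R₂ L₁ L₂ : ℂ} {ε₁ ε₂ : ℝ} (h₁ : ‖R₁ - L₁‖ ≤ ε₁) (h₂ : ‖R₂ - L₂‖ ≤ ε₂) :
    ‖(R₁ - R₂) - (L₁ - L₂)‖ ≤ ε₁ + ε₂ :=
  calc ‖(R₁ - R₂) - (L₁ - L₂)‖ = ‖(R₁ - L₁) - (R₂ - L₂)‖ := by ring_nf
    _ ≤ ‖R₁ - L₁‖ + ‖R₂ - L₂‖ := norm_sub_le _ _
    _ ≤ ε₁ + ε₂ := add_le_add h₁ h₂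

/-- **K0 FOR THE LIMIT KERNEL: `‖𝓛_∞((x,μ),(x′,ν))‖ ≤ C₀(d,a)/N^d`** (from `LongitudinalWindow.norm_Lker_le`). [folklore] -/
theorem norm_LkerLim_le (hd : 0 < d) (hn : 1 ≤ n) {a : ℝ} (ha : 0 < a) (x : Fin d → ℕ) (μ : Fin d)
    (x' : Fin d → ℕ) (ν : Fin d) : ‖LkerLim n a x μ x' ν‖ ≤ ellD0 d a / (n : ℝ) ^ d := by
  refine le_of_forall_pos_le_add fun ε hε => ?_
  obtain ⟨m₀, hm₀⟩ := Lker_tendsto_LkerLim n hd hn ha x μ x' ν hε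
  obtain ⟨m, hm0, hev, hm⟩ := exists_pos_even_ge m₀
  haveI : NeZero m := ⟨by omega⟩
  exact norm_le_of_near (norm_Lker_le n hn (cubic d m) a ha hd _ μ _ ν) (hm₀ m hev hm)

/-- **K1 (left leg) FOR THE LIMIT KERNEL: `‖𝓛_∞((x+e_ρ,μ),(x′,ν)) − 𝓛_∞((x,μ),(x′,ν))‖ ≤ C₁(d,a)/N^{d+1}`**
(from `LongitudinalWindow.norm_Lker_sub_left_le`). [folklore] -/
theorem norm_LkerLim_sub_left_le (hd : 0 < d) (hn : 1 ≤ n) {a : ℝ} (ha : 0 < a) (ρ : Fin d) (x : Fin d → ℕ)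
    (μ : Fin d) (x' : Fin d → ℕ) (ν : Fin d) :
    ‖LkerLim n a (x + Pi.single ρ 1) μ x' ν - LkerLim n a x μ x' ν‖ ≤ ellD1 d a / (n : ℝ) ^ (d + 1) := by
  refine le_of_forall_pos_le_add fun ε hε => ?_
  obtain ⟨m₁, h₁⟩ := Lker_tendsto_LkerLim n hd hn ha (x + Pi.single ρ 1) μ x' ν (half_pos hε)
  obtain ⟨m₂, h₂⟩ := Lker_tendsto_LkerLim n hd hn ha x μ x' ν (half_pos hε)
  obtain ⟨m, hm0, hev, hm⟩ := exists_pos_even_ge (max m₁ m₂)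
  haveI : NeZero m := ⟨by omega⟩
  have e1 := h₁ m hev (le_of_max_le_left hm)
  have e2 := h₂ m hev (le_of_max_le_right hm)
  rw [natPt_add_single] at e1
  have hR := norm_Lker_sub_left_le n hn (cubic d m) a ha hd ρ (fun ρ' => ((x ρ' : ℕ) : ZMod (fine n (cubic d m) ρ')))
    μ (fun ρ' => ((x' ρ' : ℕ) : ZMod (fine n (cubic d m) ρ'))) ν
  have := norm_le_of_near hR (norm_sub_sub_le_of_near e1 e2)
  linarith

/-- **K1 (right leg) FOR THE LIMIT KERNEL: `‖𝓛_∞((x,μ),(x′+e_ρ,ν)) − 𝓛_∞((x,μ),(x′,ν))‖ ≤ C₁(d,a)/N^{d+1}`**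
(from `LongitudinalWindow.norm_Lker_sub_right_le`). [folklore] -/
theorem norm_LkerLim_sub_right_le (hd : 0 < d) (hn : 1 ≤ n) {a : ℝ} (ha : 0 < a) (ρ : Fin d) (x : Fin d → ℕ)
    (μ : Fin d) (x' : Fin d → ℕ) (ν : Fin d) :
    ‖LkerLim n a x μ (x' + Pi.single ρ 1) ν - LkerLim n a x μ x' ν‖ ≤ ellD1 d a / (n : ℝ) ^ (d + 1) := by
  refine le_of_forall_pos_le_add fun ε hε => ?_
  obtain ⟨m₁, h₁⟩ := Lker_tendsto_LkerLim n hd hn ha x μ (x' + Pi.single ρ 1) ν (half_pos hε)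
  obtain ⟨m₂, h₂⟩ := Lker_tendsto_LkerLim n hd hn ha x μ x' ν (half_pos hε)
  obtain ⟨m, hm0, hev, hm⟩ := exists_pos_even_ge (max m₁ m₂)
  haveI : NeZero m := ⟨by omega⟩
  have e1 := h₁ m hev (le_of_max_le_left hm)
  have e2 := h₂ m hev (le_of_max_le_right hm)
  rw [natPt_add_single] at e1
  have hR := norm_Lker_sub_right_le n hn (cubic d m) a ha hd ρ (fun ρ' => ((x ρ' : ℕ) : ZMod (fine n (cubic d m) ρ')))
    μ (fun ρ' => ((x' ρ' : ℕ) : ZMod (fine n (cubic d m) ρ'))) ν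
  have := norm_le_of_near hR (norm_sub_sub_le_of_near e1 e2)
  linarith

/-- **K2 FOR THE LIMIT KERNEL: the mixed second difference `∇_ρ^x ∇_{ρ′}^{x′} 𝓛_∞` is `≤ C₂(d,a)/N^{d+2}`**
(from `LongitudinalWindow.norm_Lker_sub_sub_le`). [folklore] -/
theorem norm_LkerLim_sub_sub_le (hd : 0 < d) (hn : 1 ≤ n) {a : ℝ} (ha : 0 < a) (ρ ρ' : Fin d) (x : Fin d → ℕ)
    (μ : Fin d) (x' : Fin d → ℕ) (ν : Fin d) :
    ‖(LkerLim n a (x + Pi.single ρ 1) μ (x' + Pi.single ρ' 1) ν - LkerLim n a x μ (x' + Pi.single ρ' 1) ν)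
        - (LkerLim n a (x + Pi.single ρ 1) μ x' ν - LkerLim n a x μ x' ν)‖ ≤ ellD2 d a / (n : ℝ) ^ (d + 2) := by
  refine le_of_forall_pos_le_add fun ε hε => ?_
  have hε4 : 0 < ε / 4 := by positivity
  obtain ⟨m₁, h₁⟩ := Lker_tendsto_LkerLim n hd hn ha (x + Pi.single ρ 1) μ (x' + Pi.single ρ' 1) ν hε4
  obtain ⟨m₂, h₂⟩ := Lker_tendsto_LkerLim n hd hn ha x μ (x' + Pi.single ρ' 1) ν hε4
  obtain ⟨m₃, h₃⟩ := Lker_tendsto_LkerLim n hd hn ha (x + Pi.single ρ 1) μ x' ν hε4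
  obtain ⟨m₄, h₄⟩ := Lker_tendsto_LkerLim n hd hn ha x μ x' ν hε4
  obtain ⟨m, hm0, hev, hm⟩ := exists_pos_even_ge (max (max m₁ m₂) (max m₃ m₄))
  haveI : NeZero m := ⟨by omega⟩
  have e1 := h₁ m hev (le_trans (le_trans (le_max_left _ _) (le_max_left _ _)) hm)
  have e2 := h₂ m hev (le_trans (le_trans (le_max_right _ _) (le_max_left _ _)) hm)
  have e3 := h₃ m hev (le_trans (le_trans (le_max_left _ _) (le_max_right _ _)) hm)
  have e4 := h₄ m hev (le_trans (le_trans (le_max_right _ _) (le_max_right _ _)) hm)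
  rw [natPt_add_single, natPt_add_single] at e1
  rw [natPt_add_single] at e2 e3
  have hR := norm_Lker_sub_sub_le n hn (cubic d m) a ha hd ρ ρ' (fun σ => ((x σ : ℕ) : ZMod (fine n (cubic d m) σ)))
    μ (fun σ => ((x' σ : ℕ) : ZMod (fine n (cubic d m) σ))) ν
  have h12 := norm_sub_sub_le_of_near e1 e2
  have h34 := norm_sub_sub_le_of_near e3 e4
  have := norm_le_of_near hR (norm_sub_sub_le_of_near h12 h34)
  linarith

end Literature.MathematicalPhysics.QuantumFieldTheory.Balaban1983to89.Beta.LongitudinalSymbol
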